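import Mathlib
import Summits.NavierStokesRegularity.NavierStokesRegularity.Theorems.EulerZoomLiouvillePowerGaugeEulerLiouvilleAnchoredBudgetEviction
import Summits.NavierStokesRegularity.NavierStokesRegularity.Theorems.EulerZoomLiouvillePowerGaugeEulerLiouvilleSwirlfreeLedgerDecay
import Summits.NavierStokesRegularity.NavierStokesRegularity.Theorems.EulerZoomLiouvillePowerGaugeEulerLiouvilleBackwardTools
import Literature.Analysis.FluidPDE.CKNInterpolationEstimate
import Literature.Analysis.FluidPDE.SpaceTimeCalculusC1
import HarnessLib

/-!
# Crux `EulerZoomLiouville.PowerGaugeEulerLiouville` (stmt-NavierStokesRegularity-19832), line `anchored-budget`, stub C2 — part 2: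
# THE GAUGE BOOKKEEPING OF THE EVICTION BUDGET (the gauges pay `∫Φ` on a window)

Route `EulerZoomLiouville` (NavierStokesRegularity), crux E.  Line `anchored-budget` (ideator ns-idea-11 g4;
`Cruxes/PowerGaugeEulerLiouville/Lines/anchored_budget.lean`), stub C2 `stub_anchoredStarvation` (split of 2026-08-28: C1 = ns-sfl-p1 g3,
C2 = this seat).  Part 1 (`…AnchoredBudgetEviction`) bounds `∫_E ‖v‖` for `E ⊆ B(0,a)` by `|E|^{5/6} C (2∫_{B(0,2a)}|∇v|_F² + 2(M/a)²∫_{B(0,2a)}‖v‖²)^{1/2}`.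
THIS FILE feeds a classical member `u` of the power-gauged class into it on a time window `[t₁,t₀] ⊆ [−a²,0)`:

* `exists_evictionBudget` — for a classical member with the `A`- and `E`-gauges (`a^{2ρ}A(a) ≤ c`, `a^ρ E(a) ≤ c`), a cutoff `ψ` of `B(0,a)` inside
  `B(0,2a)` with `‖∇ψ‖ ≤ M/a`, a window `−a² ≤ t₁ < t₀ < 0` and a volume cap `m < ∞`, there is an EVICTION BUDGET `Φ ≥ 0`, integrable on `[t₁,t₀]`,
  with `∫_E ‖u(s)‖ ≤ Φ(s)` for all `s ∈ [t₁,t₀]` and all measurable `E ⊆ B(0,a)` with `|E| ≤ m`, and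
  `∫_{[t₁,t₀]} Φ ≤ m^{5/6} · C · √(t₀−t₁) · √(2c(2a)^{1−ρ} + 2(M/a)²(t₀−t₁)·c(2a)^{1−2ρ})`
  (`Φ(s) := m^{5/6} C (2∫_{B(0,2a)}|∇u(s)|_F² + 2(M/a)²∫_{B(0,2a)}‖u(s)‖²)^{1/2}`; Cauchy–Schwarz in time; the `E`-gauge window bound
  `SwirlfreeLedger.setLIntegral_window_frobenius_fderiv_le` at scale `2a` and the `A`-gauge slice bound `Backward.lintegral_ball_le_of_gaugeA` at scale `2a`;
  measurability of `Φ` from the joint continuity of the slice gradient of a classical solution).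

This is exactly the budget slot of `AnchoredFloorBlobs` (the C1 conclusion); part 3 (`…AnchoredBudgetStarvation`) chooses the bulk window and runs the race.

WHAT THIS IS NOT: not NS regularity, not the crux E — a helper `--supports` stmt-19832 for a stratum statement about a hypothetical Euler zoom-limit
class (MODEL lattice; crux 19832 and NS regularity stay OPEN).
[cite: CaffarelliKohnNirenberg1982, §2 (the scaled quantities A, E); doi:10.1515/crelle.2008.016 (Crippa–De Lellis 2008), §2–3 (the use of the budget)]
-/

noncomputable section

set_option linter.dupNamespace false

open MeasureTheory Set Filter Topology Metric Function
open scoped NNReal ENNReal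

namespace Summit.NavierStokesRegularity.NavierStokesRegularity.Theorems.PowerGaugeEulerLiouville.AnchoredBudget

open Literature.Analysis Literature.Analysis.FluidPDE
open Summit.NavierStokesRegularity.NavierStokesRegularity.Theorems.PowerGaugeEulerLiouville.SwirlfreeLedger
open Summit.NavierStokesRegularity.NavierStokesRegularity.Theorems.PowerGaugeEulerLiouville.Backward

variable {u : ℝ → EuclideanSpace ℝ (Fin 3) → EuclideanSpace ℝ (Fin 3)} {p : ℝ → EuclideanSpace ℝ (Fin 3) → ℝ}
  {H : ℝ → EuclideanSpace ℝ (Fin 3) → EuclideanSpace ℝ (Fin 3) →L[ℝ] EuclideanSpace ℝ (Fin 3)}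

/-! ### Slices and windows of a classical member -/

/-- Every negative-time slice of a classical Euler solution on the past is `C¹`. [folklore] -/
theorem contDiff_one_slice (hcl : IsClassicalEulerSolutionOn (Iio 0) 0 u p) {s : ℝ} (hs : s < 0) : ContDiff ℝ 1 (u s) :=
  contDiff_slice_of_contDiffOn (hcl.smooth_velocity.of_le (by exact_mod_cast le_top)) hs

/-- The product of restricted Lebesgue measures is the restriction of the space-time volume to the box. [folklore] -/
theorem prod_restrict_eq (I : Set ℝ) (B : Set (EuclideanSpace ℝ (Fin 3))) :
    ((volume : Measure ℝ).restrict I).prod ((volume : Measure (EuclideanSpace ℝ (Fin 3))).restrict B) =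
      (volume : Measure (ℝ × EuclideanSpace ℝ (Fin 3))).restrict (I ×ˢ B) := by
  rw [Measure.prod_restrict, ← Measure.volume_eq_prod]

/-- Joint a.e.-measurability of `(s,x) ↦ |∇u(s,x)|_F²` on a box `I × B`, `I ⊆ (−∞,0)` (the slice gradient of a classical solution is jointly
continuous). [folklore] -/
theorem aemeasurable_frobenius_box (hcl : IsClassicalEulerSolutionOn (Iio 0) 0 u p) {I : Set ℝ} (hI : MeasurableSet I)
    (hI0 : I ⊆ Iio 0) {B : Set (EuclideanSpace ℝ (Fin 3))} (hB : MeasurableSet B) :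
    AEMeasurable (uncurry fun (s : ℝ) (x : EuclideanSpace ℝ (Fin 3)) => ENNReal.ofReal (frobeniusNormSq (fderiv ℝ (u s) x)))
      (((volume : Measure ℝ).restrict I).prod ((volume : Measure (EuclideanSpace ℝ (Fin 3))).restrict B)) := by
  rw [prod_restrict_eq]
  have hD : ContinuousOn (uncurry fun (t : ℝ) (x : EuclideanSpace ℝ (Fin 3)) => fderiv ℝ (u t) x)
      (Iio (0 : ℝ) ×ˢ (univ : Set (EuclideanSpace ℝ (Fin 3)))) :=
    (hcl.smooth_velocity.fderiv_slice isOpen_Iio.uniqueDiffOn).continuousOn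
  have hF : ContinuousOn (fun z : ℝ × EuclideanSpace ℝ (Fin 3) => frobeniusNormSq (fderiv ℝ (u z.1) z.2))
      (Iio (0 : ℝ) ×ˢ (univ : Set (EuclideanSpace ℝ (Fin 3)))) :=
    continuous_frobeniusNormSq'.comp_continuousOn hD
  exact ((hF.mono (prod_mono hI0 (subset_univ _))).aemeasurable (hI.prod hB)).ennreal_ofReal

/-- Joint a.e.-measurability of `(s,x) ↦ ‖u(s,x)‖²` on a box `I × B`, `I ⊆ (−∞,0)`. [folklore] -/
theorem aemeasurable_enorm_sq_box (hcl : IsClassicalEulerSolutionOn (Iio 0) 0 u p) {I : Set ℝ} (hI : MeasurableSet I)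
    (hI0 : I ⊆ Iio 0) {B : Set (EuclideanSpace ℝ (Fin 3))} (hB : MeasurableSet B) :
    AEMeasurable (uncurry fun (s : ℝ) (x : EuclideanSpace ℝ (Fin 3)) => ‖u s x‖ₑ ^ 2)
      (((volume : Measure ℝ).restrict I).prod ((volume : Measure (EuclideanSpace ℝ (Fin 3))).restrict B)) := by
  rw [prod_restrict_eq]
  have hc : ContinuousOn (uncurry u) (Iio (0 : ℝ) ×ˢ (univ : Set (EuclideanSpace ℝ (Fin 3)))) :=
    hcl.smooth_velocity.continuousOn
  exact (((hc.mono (prod_mono hI0 (subset_univ _))).aemeasurable (hI.prod hB)).enorm.pow_const 2)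

/-- The local Dirichlet integral of a negative-time slice is finite (a continuous integrand on a bounded ball). [folklore] -/
theorem lintegral_ball_frobenius_ne_top (hcl : IsClassicalEulerSolutionOn (Iio 0) 0 u p) {s : ℝ} (hs : s < 0) (r : ℝ) :
    ∫⁻ x in ball (0 : EuclideanSpace ℝ (Fin 3)) r, ENNReal.ofReal (frobeniusNormSq (fderiv ℝ (u s) x)) ≠ ⊤ := by
  have hcont : Continuous fun x => frobeniusNormSq (fderiv ℝ (u s) x) :=
    continuous_frobeniusNormSq_fderiv (contDiff_one_slice hcl hs) one_ne_zero
  obtain ⟨R, hR⟩ := (isCompact_closedBall (0 : EuclideanSpace ℝ (Fin 3)) r).exists_bound_of_continuousOn hcont.continuousOn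
  refine ne_top_of_le_ne_top (b := ENNReal.ofReal R * volume (ball (0 : EuclideanSpace ℝ (Fin 3)) r))
    (ENNReal.mul_ne_top ENNReal.ofReal_ne_top
      (measure_ball_lt_top : volume (ball (0 : EuclideanSpace ℝ (Fin 3)) r) < ⊤).ne) ?_
  calc ∫⁻ x in ball (0 : EuclideanSpace ℝ (Fin 3)) r, ENNReal.ofReal (frobeniusNormSq (fderiv ℝ (u s) x))
      ≤ ∫⁻ x in ball (0 : EuclideanSpace ℝ (Fin 3)) r, ENNReal.ofReal R := by
        refine setLIntegral_mono measurable_const fun x hx => ENNReal.ofReal_le_ofReal ?_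
        exact (le_abs_self _).trans ((Real.norm_eq_abs _).symm.le.trans (hR x (ball_subset_closedBall hx)))
    _ = ENNReal.ofReal R * volume (ball (0 : EuclideanSpace ℝ (Fin 3)) r) := setLIntegral_const _ _

/-! ### The eviction budget of a member on a window -/

/-- **THE EVICTION BUDGET FROM THE GAUGES.**  Let `u` be a classical Euler solution on the past with a weak gradient `H`, the `A`-gauge
`a^{2ρ} A(a) ≤ c` and the `E`-gauge `a^ρ E(a) ≤ c` at every scale; let `C` be a GNS eviction constant and `ψ` a cutoff of `B(0,a)` inside `B(0,2a)`
with `‖∇ψ‖ ≤ M/a`; let `−a² ≤ t₁ < t₀ < 0` and `m < ∞`.  Then there is `Φ ≥ 0`, integrable on `[t₁,t₀]`, with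
`∫_E ‖u(s)‖ ≤ Φ(s)` for all `s ∈ [t₁,t₀]` and measurable `E ⊆ B(0,a)` with `|E| ≤ m`, and
`∫_{[t₁,t₀]} Φ ≤ m^{5/6} · C · √(t₀−t₁) · √(2·c(2a)^{1−ρ} + 2(M/a)²(t₀−t₁)·c(2a)^{1−2ρ})`.
[cite: CaffarelliKohnNirenberg1982, §2; folklore (Gagliardo–Nirenberg–Sobolev, Cauchy–Schwarz)] -/
theorem exists_evictionBudget {ρ : ℝ} {c : ℝ≥0}
    (hH : HasWeakSpatialGradientOn (slab (EuclideanSpace ℝ (Fin 3)) (Iio 0) isOpen_Iio) u H)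
    (hcl : IsClassicalEulerSolutionOn (Iio 0) 0 u p)
    (hA : ∀ a : ℝ, 0 < a →
      ENNReal.ofReal (a ^ (2 * ρ)) * cknA a (0 : ℝ × EuclideanSpace ℝ (Fin 3)) u ≤ (c : ℝ≥0∞))
    (hE : ∀ a : ℝ, 0 < a →
      ENNReal.ofReal (a ^ ρ) * cknE a (0 : ℝ × EuclideanSpace ℝ (Fin 3)) H ≤ (c : ℝ≥0∞))
    {C : ℝ≥0}
    (hC : ∀ (w : EuclideanSpace ℝ (Fin 3) → EuclideanSpace ℝ (Fin 3)), ContDiff ℝ 1 w → HasCompactSupport w →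
      ∀ E : Set (EuclideanSpace ℝ (Fin 3)), MeasurableSet E →
        ∫⁻ x in E, ‖w x‖ₑ ≤ volume E ^ (5 / 6 : ℝ) * C * (∫⁻ x, ‖fderiv ℝ w x‖ₑ ^ 2) ^ (1 / 2 : ℝ))
    {ψ : EuclideanSpace ℝ (Fin 3) → ℝ} {a M : ℝ} (ha : 0 < a) (hψ : ContDiff ℝ 1 ψ) (hψc : HasCompactSupport ψ)
    (h0 : ∀ x, 0 ≤ ψ x) (h1 : ∀ x, ψ x ≤ 1) (hone : ∀ x ∈ ball (0 : EuclideanSpace ℝ (Fin 3)) a, ψ x = 1)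
    (hts : tsupport ψ ⊆ ball (0 : EuclideanSpace ℝ (Fin 3)) (2 * a)) (hM : ∀ x, ‖fderiv ℝ ψ x‖ ≤ M / a)
    {t₁ t₀ : ℝ} (ht : t₁ < t₀) (ht₀ : t₀ < 0) (hwin : -a ^ 2 ≤ t₁) {m : ℝ≥0∞} (hm : m ≠ ⊤) :
    ∃ Φ : ℝ → ℝ, IntegrableOn Φ (Icc t₁ t₀) ∧ (∀ s ∈ Icc t₁ t₀, 0 ≤ Φ s) ∧
      (∀ s ∈ Icc t₁ t₀, ∀ E : Set (EuclideanSpace ℝ (Fin 3)), MeasurableSet E →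
        E ⊆ ball (0 : EuclideanSpace ℝ (Fin 3)) a → volume E ≤ m → ∫⁻ x in E, ‖u s x‖ₑ ≤ ENNReal.ofReal (Φ s)) ∧
      ∫ s in Icc t₁ t₀, Φ s ≤ m.toReal ^ (5 / 6 : ℝ) * C * Real.sqrt (t₀ - t₁) *
        Real.sqrt (2 * ((c : ℝ) * (2 * a) ^ (1 - ρ)) + 2 * (M / a) ^ 2 * (t₀ - t₁) * ((c : ℝ) * (2 * a) ^ (1 - 2 * ρ))) := by
  -- the window and the ball of the gauges (scale `2a`)
  set I : Set ℝ := Icc t₁ t₀ with hI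
  set B₂ : Set (EuclideanSpace ℝ (Fin 3)) := ball 0 (2 * a) with hB₂
  have h2a : 0 < 2 * a := by linarith
  have hI0 : I ⊆ Iio 0 := fun s hs => lt_of_le_of_lt hs.2 ht₀
  have hIsub : I ⊆ Ioo (-(2 * a) ^ 2) 0 := fun s hs => ⟨by nlinarith [hs.1, ha], lt_of_le_of_lt hs.2 ht₀⟩
  have hS0 : 0 ≤ t₀ - t₁ := by linarith
  have hvolI : volume I = ENNReal.ofReal (t₀ - t₁) := Real.volume_Icc
  -- the slice quantities and the budget
  set X : ℝ → ℝ≥0∞ := fun s => ∫⁻ x in B₂, ENNReal.ofReal (frobeniusNormSq (fderiv ℝ (u s) x)) with hX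
  set Y : ℝ → ℝ≥0∞ := fun s => ∫⁻ x in B₂, ‖u s x‖ₑ ^ 2 with hY
  set G : ℝ → ℝ≥0∞ := fun s => 2 * X s + 2 * ENNReal.ofReal ((M / a) ^ 2) * Y s with hG
  set Φ : ℝ → ℝ := fun s => m.toReal ^ (5 / 6 : ℝ) * C * Real.sqrt ((G s).toReal) with hΦ
  have hΦ0 : ∀ s, 0 ≤ Φ s := fun s => by positivity
  -- the `A`-gauge slice bound and finiteness of `G` on the window
  have hYle : ∀ s ∈ I, Y s ≤ ENNReal.ofReal ((c : ℝ) * (2 * a) ^ (1 - 2 * ρ)) := fun s hs =>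
    lintegral_ball_le_of_gaugeA h2a (hA _ h2a) (hIsub hs)
  have hGtop : ∀ s ∈ I, G s ≠ ⊤ := by
    intro s hs
    refine ENNReal.add_ne_top.2 ⟨ENNReal.mul_ne_top ENNReal.ofNat_ne_top (lintegral_ball_frobenius_ne_top hcl (hI0 hs) _),
      ENNReal.mul_ne_top (ENNReal.mul_ne_top ENNReal.ofNat_ne_top ENNReal.ofReal_ne_top) ?_⟩
    exact ne_top_of_le_ne_top ENNReal.ofReal_ne_top (hYle s hs)
  -- `ofReal Φ ≤ m^{5/6} C G^{1/2}`, with equality where `G < ∞`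
  have hΦle : ∀ s, ENNReal.ofReal (Φ s) ≤ m ^ (5 / 6 : ℝ) * C * G s ^ (1 / 2 : ℝ) := by
    intro s
    rw [hΦ]
    simp only []
    rw [ENNReal.ofReal_mul (by positivity), ENNReal.ofReal_mul (by positivity),
      ← ENNReal.ofReal_rpow_of_nonneg ENNReal.toReal_nonneg (by norm_num), ENNReal.ofReal_toReal hm, ENNReal.ofReal_coe_nnreal,
      Real.sqrt_eq_rpow, ← ENNReal.ofReal_rpow_of_nonneg ENNReal.toReal_nonneg (by norm_num)]
    gcongr
    exact ENNReal.ofReal_toReal_le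
  have hΦeq : ∀ s ∈ I, ENNReal.ofReal (Φ s) = m ^ (5 / 6 : ℝ) * C * G s ^ (1 / 2 : ℝ) := by
    intro s hs
    rw [hΦ]
    simp only []
    rw [ENNReal.ofReal_mul (by positivity), ENNReal.ofReal_mul (by positivity),
      ← ENNReal.ofReal_rpow_of_nonneg ENNReal.toReal_nonneg (by norm_num), ENNReal.ofReal_toReal hm, ENNReal.ofReal_coe_nnreal,
      Real.sqrt_eq_rpow, ← ENNReal.ofReal_rpow_of_nonneg ENNReal.toReal_nonneg (by norm_num), ENNReal.ofReal_toReal (hGtop s hs)]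
  -- (ii) the eviction inequality
  have hev : ∀ s ∈ I, ∀ E : Set (EuclideanSpace ℝ (Fin 3)), MeasurableSet E →
      E ⊆ ball (0 : EuclideanSpace ℝ (Fin 3)) a → volume E ≤ m → ∫⁻ x in E, ‖u s x‖ₑ ≤ ENNReal.ofReal (Φ s) := by
    intro s hs E hEm hEa hEvol
    have h := eviction_of_cutoff hC (contDiff_one_slice hcl (hI0 hs)) hψ hψc h0 h1 hone hts hM hEm hEa
    rw [hΦeq s hs]
    refine h.trans ?_
    gcongr
  -- measurability of `X`, `Y`, `G`, `Φ` on the window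
  have hXm : AEMeasurable X (volume.restrict I) :=
    (aemeasurable_frobenius_box hcl measurableSet_Icc hI0 measurableSet_ball).lintegral_prod_right'
  have hYm : AEMeasurable Y (volume.restrict I) :=
    (aemeasurable_enorm_sq_box hcl measurableSet_Icc hI0 measurableSet_ball).lintegral_prod_right'
  have hGm : AEMeasurable G (volume.restrict I) := (hXm.const_mul _).add (hYm.const_mul _)
  have hΦm : AEStronglyMeasurable Φ (volume.restrict I) :=
    ((Real.continuous_sqrt.measurable.comp_aemeasurable hGm.ennreal_toReal).const_mul _).aestronglyMeasurable
  -- the window integrals of `X` and `Y`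
  have hXint : ∫⁻ s in I, X s ≤ ENNReal.ofReal ((c : ℝ) * (2 * a) ^ (1 - ρ)) := by
    have hT := lintegral_lintegral (aemeasurable_frobenius_box hcl measurableSet_Icc hI0 (measurableSet_ball (x := (0 :
      EuclideanSpace ℝ (Fin 3))) (ε := 2 * a)))
    rw [prod_restrict_eq] at hT
    calc ∫⁻ s in I, X s = ∫⁻ z in I ×ˢ B₂, ENNReal.ofReal (frobeniusNormSq (fderiv ℝ (u z.1) z.2)) := hT
      _ ≤ ∫⁻ z in Ioo (-(2 * a) ^ 2) 0 ×ˢ ball (0 : EuclideanSpace ℝ (Fin 3)) (2 * a),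
            ENNReal.ofReal (frobeniusNormSq (fderiv ℝ (u z.1) z.2)) := lintegral_mono_set (prod_mono hIsub subset_rfl)
      _ ≤ ENNReal.ofReal ((c : ℝ) * (2 * a) ^ (1 - ρ)) := setLIntegral_window_frobenius_fderiv_le hH hcl hE h2a
  have hYint : ∫⁻ s in I, Y s ≤ ENNReal.ofReal (t₀ - t₁) * ENNReal.ofReal ((c : ℝ) * (2 * a) ^ (1 - 2 * ρ)) := by
    calc ∫⁻ s in I, Y s ≤ ∫⁻ s in I, ENNReal.ofReal ((c : ℝ) * (2 * a) ^ (1 - 2 * ρ)) :=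
          setLIntegral_mono measurable_const fun s hs => hYle s hs
      _ = ENNReal.ofReal ((c : ℝ) * (2 * a) ^ (1 - 2 * ρ)) * volume I := setLIntegral_const _ _
      _ = ENNReal.ofReal (t₀ - t₁) * ENNReal.ofReal ((c : ℝ) * (2 * a) ^ (1 - 2 * ρ)) := by rw [hvolI, mul_comm]
  -- the window integral of `G`
  set Q : ℝ := 2 * ((c : ℝ) * (2 * a) ^ (1 - ρ)) + 2 * (M / a) ^ 2 * (t₀ - t₁) * ((c : ℝ) * (2 * a) ^ (1 - 2 * ρ)) with hQ
  have hcE : 0 ≤ (c : ℝ) * (2 * a) ^ (1 - ρ) := by positivity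
  have hcA : 0 ≤ (c : ℝ) * (2 * a) ^ (1 - 2 * ρ) := by positivity
  have hm2 : 0 ≤ 2 * (M / a) ^ 2 := by positivity
  have hm2S : 0 ≤ 2 * (M / a) ^ 2 * (t₀ - t₁) := mul_nonneg hm2 hS0
  have hQ0 : 0 ≤ Q := add_nonneg (by positivity) (mul_nonneg hm2S hcA)
  have hQe : ENNReal.ofReal Q = 2 * ENNReal.ofReal ((c : ℝ) * (2 * a) ^ (1 - ρ)) +
      2 * ENNReal.ofReal ((M / a) ^ 2) * (ENNReal.ofReal (t₀ - t₁) * ENNReal.ofReal ((c : ℝ) * (2 * a) ^ (1 - 2 * ρ))) := by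
    rw [hQ, ENNReal.ofReal_add (by positivity) (mul_nonneg hm2S hcA), ENNReal.ofReal_mul (by norm_num : (0 : ℝ) ≤ 2),
      ENNReal.ofReal_mul hm2S, ENNReal.ofReal_mul hm2, ENNReal.ofReal_mul (by norm_num : (0 : ℝ) ≤ 2), ENNReal.ofReal_ofNat]
    ring
  have hGint : ∫⁻ s in I, G s ≤ ENNReal.ofReal Q := by
    have e : ∫⁻ s in I, G s = (2 * ∫⁻ s in I, X s) + 2 * ENNReal.ofReal ((M / a) ^ 2) * ∫⁻ s in I, Y s := by
      rw [hG]
      simp only []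
      rw [lintegral_add_left' (hXm.const_mul _), lintegral_const_mul'' _ hXm, lintegral_const_mul'' _ hYm]
    rw [e, hQe]
    exact add_le_add (mul_le_mul_right hXint _) (mul_le_mul_right hYint _)
  -- Cauchy–Schwarz in time: `∫ G^{1/2} ≤ |I|^{1/2} (∫ G)^{1/2}`
  have hCS : ∫⁻ s in I, G s ^ (1 / 2 : ℝ) ≤ volume I ^ (1 / 2 : ℝ) * (∫⁻ s in I, G s) ^ (1 / 2 : ℝ) := by
    have h := ENNReal.lintegral_mul_le_Lp_mul_Lq (volume.restrict I) Real.HolderConjugate.two_two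
      (f := fun _ => (1 : ℝ≥0∞)) (g := fun s => G s ^ (1 / 2 : ℝ)) aemeasurable_const (hGm.pow_const _)
    have e1 : ∫⁻ s in I, ((fun _ : ℝ => (1 : ℝ≥0∞)) * fun s : ℝ => G s ^ (1 / 2 : ℝ)) s = ∫⁻ s in I, G s ^ (1 / 2 : ℝ) := by
      simp only [Pi.mul_apply, one_mul]
    have e2 : ∫⁻ _ in I, (1 : ℝ≥0∞) ^ (2 : ℝ) = volume I := by
      rw [ENNReal.one_rpow, setLIntegral_const, one_mul]
    have e3 : ∫⁻ s in I, (G s ^ (1 / 2 : ℝ)) ^ (2 : ℝ) = ∫⁻ s in I, G s := by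
      refine lintegral_congr fun s => ?_
      rw [← ENNReal.rpow_mul]
      norm_num
    rwa [e1, e2, e3] at h
  -- the master bound in `ℝ≥0∞`
  have hmaster : ∫⁻ s in I, ENNReal.ofReal (Φ s) ≤
      m ^ (5 / 6 : ℝ) * C * (ENNReal.ofReal (t₀ - t₁) ^ (1 / 2 : ℝ) * ENNReal.ofReal Q ^ (1 / 2 : ℝ)) := by
    calc ∫⁻ s in I, ENNReal.ofReal (Φ s) ≤ ∫⁻ s in I, m ^ (5 / 6 : ℝ) * C * G s ^ (1 / 2 : ℝ) := lintegral_mono fun s => hΦle s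
      _ = m ^ (5 / 6 : ℝ) * C * ∫⁻ s in I, G s ^ (1 / 2 : ℝ) := by rw [lintegral_const_mul'' _ (hGm.pow_const _)]
      _ ≤ m ^ (5 / 6 : ℝ) * C * (volume I ^ (1 / 2 : ℝ) * (∫⁻ s in I, G s) ^ (1 / 2 : ℝ)) := by gcongr
      _ ≤ m ^ (5 / 6 : ℝ) * C * (ENNReal.ofReal (t₀ - t₁) ^ (1 / 2 : ℝ) * ENNReal.ofReal Q ^ (1 / 2 : ℝ)) := by
          rw [hvolI]; gcongr
  have htop : m ^ (5 / 6 : ℝ) * C * (ENNReal.ofReal (t₀ - t₁) ^ (1 / 2 : ℝ) * ENNReal.ofReal Q ^ (1 / 2 : ℝ)) ≠ ⊤ :=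
    ENNReal.mul_ne_top (ENNReal.mul_ne_top (ENNReal.rpow_ne_top_of_nonneg (by norm_num) hm) ENNReal.coe_ne_top)
      (ENNReal.mul_ne_top (ENNReal.rpow_ne_top_of_nonneg (by norm_num) ENNReal.ofReal_ne_top)
        (ENNReal.rpow_ne_top_of_nonneg (by norm_num) ENNReal.ofReal_ne_top))
  -- (i) integrability
  have henorm : ∀ s, ‖Φ s‖ₑ = ENNReal.ofReal (Φ s) := fun s => Real.enorm_of_nonneg (hΦ0 s)
  have hInt : IntegrableOn Φ I := by
    refine ⟨hΦm, ?_⟩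
    rw [HasFiniteIntegral]
    calc ∫⁻ s in I, ‖Φ s‖ₑ = ∫⁻ s in I, ENNReal.ofReal (Φ s) := lintegral_congr fun s => henorm s
      _ ≤ _ := hmaster
      _ < ⊤ := lt_top_iff_ne_top.2 htop
  -- (iii) the bound on `∫Φ`
  have hIII : ∫ s in I, Φ s ≤ m.toReal ^ (5 / 6 : ℝ) * C * Real.sqrt (t₀ - t₁) * Real.sqrt Q := by
    rw [integral_eq_lintegral_of_nonneg_ae (Eventually.of_forall hΦ0) hΦm]
    refine (ENNReal.toReal_mono htop hmaster).trans (le_of_eq ?_)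
    rw [ENNReal.toReal_mul, ENNReal.toReal_mul, ENNReal.toReal_mul, ← ENNReal.toReal_rpow, ← ENNReal.toReal_rpow,
      ← ENNReal.toReal_rpow, ENNReal.toReal_ofReal hS0, ENNReal.toReal_ofReal hQ0, ENNReal.coe_toReal, Real.sqrt_eq_rpow,
      Real.sqrt_eq_rpow]
    ring
  exact ⟨Φ, hInt, fun s _ => hΦ0 s, hev, hIII⟩

end Summit.NavierStokesRegularity.NavierStokesRegularity.Theorems.PowerGaugeEulerLiouville.AnchoredBudget

end
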